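import Literature.Analysis.FluidPDE.ForwardDSSAprioriAssembly
import Literature.Analysis.FluidPDE.ForwardDSSCylinderCompactnessHolds
import Literature.Analysis.FluidPDE.ChaeWolfLocalLerayProofs
import HarnessLib

/-!
# Bradshaw–Tsai 2019, Thm 1.2 / Prop. 3.1 and Chae–Wolf 2018, Thm 1.4 reduced to the last
  undischarged ingredient (the mollified approximants `bradshawTsai2019_mollifiedScheme`)

Analysis/FluidPDE proof file (theorems only, no definitions, no named facts), sibling of
`ForwardDSSExistenceBT1Reduction.lean` (which does the same for [BT1] Thm 1.2). The named facts

* `Literature.Analysis.FluidPDE.bradshawTsai2019_dss_existence` — Bradshaw–Tsai, Analysis & PDE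
  12 (2019) 1943–1962 = arXiv:1801.08060, **Theorem 1.2** (forward `λ`-DSS local Leray solutions
  for every divergence free `λ`-DSS datum in `L²_loc`), and
* `Literature.Analysis.FluidPDE.chaeWolf2018_dss_existence` — Chae–Wolf, Ann. Inst. H. Poincaré C
  Anal. Non Linéaire 35 (2018) 1019–1039 = arXiv:1610.01386, **Theorem 1.4** (the same existence
  statement without pressure; "a slight refinement of the main result of [Chae–Wolf]",
  Bradshaw–Tsai 2019, Comments on Thm 1.2, whence `chaeWolf2018_dss_existence_of_bradshawTsai2019`)

have their printed proof (Bradshaw–Tsai 2019, §3–§4) vendored in the tree as a DAG of named facts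
with proved assemblies (`ForwardDSS*.lean`). After the discharges
`bradshawTsai2019_lemma_4_1_holds` (Lemma 4.1, `ForwardDSSApproximation`),
`bradshawTsai2019_cylinderCompactness_holds` / `_limitDatum_holds` / `_limit_4_3_local_holds`
(§4.2–§4.3, `ForwardDSSCylinderCompactnessHolds`, `ForwardDSSLimitDatumProofs`) and — the last
one to land — `bradshawTsai2019_apriori_3_12_holds` (the a priori estimate (3.12) with the pressure
bound of p. 10, `ForwardDSSAprioriAssembly`), the accepted two-hypothesis assemblies
`…_of_mollifiedScheme_apriori` / `…_of_parts(')` leave exactly ONE undischarged leaf under both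
theorems: `bradshawTsai2019_mollifiedScheme` (`ForwardDSSMollifiedScheme`: [BT1]'s construction
for `L³_w` data together with the mollified approximants `(v_ε, π_ε)` of (3.4)–(3.5) in the class
`BradshawTsai2019.IsMollifiedApproximant` and their convergences, pp. 8–10).

This file composes those assemblies with `bradshawTsai2019_apriori_3_12_holds`: **Prop. 3.1 (in
its three renderings), Theorem 1.2, the historical `chae_wolf_dss_existence`, Chae–Wolf's
Theorem 1.4 as rendered (`chaeWolf2018_dss_existence`) and in printed form (a field with the
clauses of Definition 1.2 (1)–(3) and (B.9), `ChaeWolf2018.IsDSSLocalLeraySolution`) each follow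
from the single named fact `bradshawTsai2019_mollifiedScheme`.** The trust base of all of them in
the tree is thereby exactly `{bradshawTsai2019_mollifiedScheme}`, and their discharges, once
`bradshawTsai2019_mollifiedScheme_holds` lands, are the one-liners
`bradshawTsai2019_dss_existence_of_mollifiedScheme bradshawTsai2019_mollifiedScheme_holds` and
`chaeWolf2018_dss_existence_of_mollifiedScheme bradshawTsai2019_mollifiedScheme_holds`.

Nothing is restated: the file only imports the accepted fact/assembly/proof files named above.

## Mathlib / tree search

`lean search 'of_mollifiedScheme\b'`: no single-hypothesis reduction before this file; the
two-hypothesis ones (`bradshawTsai2019_prop_3_1_approximation_of_parts`, `…_scheme_of_parts`,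
`…_dss_of_parts'`, `…_prop_3_1_of_parts'` in `ForwardDSSMollifiedScheme`;
`bradshawTsai2019_dss_existence_of_mollifiedScheme_apriori`,
`chae_wolf_dss_existence_of_mollifiedScheme_apriori`,
`chaeWolf2018_dss_existence_of_mollifiedScheme_apriori` in `ForwardDSSCylinderCompactnessHolds`)
and `ChaeWolf2018.exists_isDSSLocalLeraySolution_of_dss_existence` (`ChaeWolfLocalLerayProofs`)
are reused as they stand.

## References

* Z. Bradshaw, T.-P. Tsai, *Discretely self-similar solutions to the Navier–Stokes equations with
  data in `L²_loc` satisfying the local energy inequality*, Analysis & PDE 12 (2019) 1943–1962 =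
  arXiv:1801.08060: Thm 1.2 and Comments, Prop. 3.1 and its proof (pp. 8–10), §4
  [BradshawTsai2019].
* D. Chae, J. Wolf, *Existence of discretely self-similar solutions to the Navier–Stokes equations
  for initial value in `L²_loc(ℝ³)`*, Ann. Inst. H. Poincaré C Anal. Non Linéaire 35 (2018)
  1019–1039 = arXiv:1610.01386: Def. 1.2, Thm 1.4 [ChaeWolf2018].
-/

noncomputable section

open MeasureTheory

namespace Literature.Analysis.FluidPDE

/-! ## Prop. 3.1 from the mollified approximants alone -/

/-- **The approximation fact `bradshawTsai2019_prop_3_1_approximation` from (a) alone**: the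
assembly `bradshawTsai2019_prop_3_1_approximation_of_parts` fed with the discharged a priori
estimate (3.12) (`bradshawTsai2019_apriori_3_12_holds`). [cite: BradshawTsai2019, §3 proof of Prop 3.1 (pp. 8–10)] -/
theorem bradshawTsai2019_prop_3_1_approximation_of_mollifiedScheme
    (hA : bradshawTsai2019_mollifiedScheme) : bradshawTsai2019_prop_3_1_approximation :=
  bradshawTsai2019_prop_3_1_approximation_of_parts hA bradshawTsai2019_apriori_3_12_holds

/-- **The scheme form of Prop. 3.1 (`bradshawTsai2019_prop_3_1_scheme`) from (a) alone.** [cite: BradshawTsai2019, §3 proof of Prop 3.1 (pp. 8–10)] -/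
theorem bradshawTsai2019_prop_3_1_scheme_of_mollifiedScheme
    (hA : bradshawTsai2019_mollifiedScheme) : bradshawTsai2019_prop_3_1_scheme :=
  bradshawTsai2019_prop_3_1_scheme_of_parts hA bradshawTsai2019_apriori_3_12_holds

/-- **Prop. 3.1 with the DSS pressure clause (`bradshawTsai2019_prop_3_1_dss`) from (a) alone.** [cite: BradshawTsai2019, Prop 3.1 (proof pp. 8–10)] -/
theorem bradshawTsai2019_prop_3_1_dss_of_mollifiedScheme
    (hA : bradshawTsai2019_mollifiedScheme) : bradshawTsai2019_prop_3_1_dss :=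
  bradshawTsai2019_prop_3_1_dss_of_parts' hA bradshawTsai2019_apriori_3_12_holds

/-- **Prop. 3.1 as rendered in `ForwardDSSExistence.lean` (`bradshawTsai2019_prop_3_1`) from (a)
alone**: the trust base of Prop. 3.1 in the tree is `{bradshawTsai2019_mollifiedScheme}`. [cite: BradshawTsai2019, Prop 3.1 (proof pp. 8–10)] -/
theorem bradshawTsai2019_prop_3_1_of_mollifiedScheme
    (hA : bradshawTsai2019_mollifiedScheme) : bradshawTsai2019_prop_3_1 :=
  bradshawTsai2019_prop_3_1_of_parts' hA bradshawTsai2019_apriori_3_12_holds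

/-! ## Theorem 1.2 and Chae–Wolf's Theorem 1.4 from the mollified approximants alone -/

/-- **Bradshaw–Tsai 2019, Theorem 1.2 (`bradshawTsai2019_dss_existence`) from the single
remaining named fact `bradshawTsai2019_mollifiedScheme`** (Lemma 4.1, the a priori estimate
(3.12) and the limit steps of §4.2–§4.3 being discharged). Its discharge, once
`bradshawTsai2019_mollifiedScheme_holds` lands, is this theorem applied to it. [cite: BradshawTsai2019, Thm 1.2 (proof, §3–§4)] -/
theorem bradshawTsai2019_dss_existence_of_mollifiedScheme
    (hA : bradshawTsai2019_mollifiedScheme) : bradshawTsai2019_dss_existence :=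
  bradshawTsai2019_dss_existence_of_mollifiedScheme_apriori hA bradshawTsai2019_apriori_3_12_holds

/-- The historical `chae_wolf_dss_existence` from `bradshawTsai2019_mollifiedScheme` alone. [cite: BradshawTsai2019, Thm 1.2] -/
theorem chae_wolf_dss_existence_of_mollifiedScheme (hA : bradshawTsai2019_mollifiedScheme) :
    chae_wolf_dss_existence :=
  chae_wolf_dss_existence_of_mollifiedScheme_apriori hA bradshawTsai2019_apriori_3_12_holds

/-- **Chae–Wolf 2018, Theorem 1.4 as rendered (`chaeWolf2018_dss_existence`) from the single
remaining named fact `bradshawTsai2019_mollifiedScheme`** (through Bradshaw–Tsai's Theorem 1.2,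
"a slight refinement of the main result of [Chae–Wolf]"). Its discharge, once
`bradshawTsai2019_mollifiedScheme_holds` lands, is this theorem applied to it. [cite: BradshawTsai2019, Comments on Thm 1.2; ChaeWolf2018, Thm 1.4] -/
theorem chaeWolf2018_dss_existence_of_mollifiedScheme (hA : bradshawTsai2019_mollifiedScheme) :
    chaeWolf2018_dss_existence :=
  chaeWolf2018_dss_existence_of_mollifiedScheme_apriori hA bradshawTsai2019_apriori_3_12_holds

/-- **Chae–Wolf 2018, Theorem 1.4 in printed form from `bradshawTsai2019_mollifiedScheme`
alone**: for every `λ > 1` and every `λ`-DSS datum `u₀ ∈ L²_{loc,σ}(ℝ³)` there is a field `u` with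
the clauses of Definition 1.2 (1)–(3) and the slice self-similarity (B.9)
(`ChaeWolf2018.IsDSSLocalLeraySolution λ u₀ u`, `ChaeWolfLocalLerayProofs.lean`). [cite: ChaeWolf2018, Thm 1.4 with Def 1.2 (1)–(3) and Lemma B.5 (B.9)] -/
theorem ChaeWolf2018.exists_isDSSLocalLeraySolution_of_mollifiedScheme
    (hA : bradshawTsai2019_mollifiedScheme) {c : ℝ} (hc : 1 < c)
    {u₀ : EuclideanSpace ℝ (Fin 3) → EuclideanSpace ℝ (Fin 3)}
    (hm₀ : AEStronglyMeasurable u₀ volume) (hL2 : LocallyIntegrable (fun x => ‖u₀ x‖ ^ 2) volume)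
    (hdiv : IsWeaklyDivFree u₀) (hdss : nsRescaleData c u₀ = u₀) :
    ∃ u : ℝ → EuclideanSpace ℝ (Fin 3) → EuclideanSpace ℝ (Fin 3),
      ChaeWolf2018.IsDSSLocalLeraySolution c u₀ u :=
  ChaeWolf2018.exists_isDSSLocalLeraySolution_of_dss_existence
    (chaeWolf2018_dss_existence_of_mollifiedScheme hA) hc hm₀ hL2 hdiv hdss

end Literature.Analysis.FluidPDE

end
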